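import Summits.QuantumFields.QCD.Theorems.QuarksAsStableActionCriticalLineDiamagnetismCheckerDefs

/-!
# Block-margin certificate checker — soundness, part 1 (crux stmt-QuantumFields-9734, line `Sketch`, lead c3)

Soundness of the exact-rational per-block test and of the bisection driver of `…CheckerDefs.lean`:

* `ldlPos_sound` (positive `LDLᵀ` pivots ⇒ nonnegative real form; Schur complements), `blockOK_sound`: entrywise
  enclosures `lo ≤ Hm ≤ hi` of a symmetric real kernel on `range n` plus `blockOK γ n lo hi` give
  `64 n γ Σ yᵢ² ≤ Σ yᵢ Hmᵢⱼ yⱼ` for every `y` with `Σ yᵢ = 0` (Abel transform `y = Pz`, `Pᵀ X P ≻ 0`, symmetrised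
  Gershgorin absorption of the radii);
* `certify_sound`: if accepted leaves prove `P` on their box, an accepted box proves `P` at every SORTED point of it
  (boxes missing the chamber are discarded; the two halves of a bisection cover the box);
* `blockHc_symm`, `bitsFun_bijective`, `bitsFun_xor`, `sum_class_eq_sum_range` (classes as the sixteen bit masks).

Pure theorem file; no definitions, no facts, no axioms.
-/

namespace Summit.QuantumFields.QCD.Cruxes.CriticalLineDiamagnetism.ChessboardCellGain.Checker

open Finset

/-- The closed form is symmetric in `μ, ν`. -/
theorem blockHc_symm (C : Fin 4 → ℝ) (s : Fin 4 → ZMod 2) (μ ν : Fin 4) : blockHc C s μ ν = blockHc C s ν μ :=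
  stub_checkerBlockHcSymm C s μ ν
/-! ## Soundness, part 1 -/

/-! ### The `LDLᵀ` block test -/

/-- Schur complement identity for a symmetric real kernel on `range (k+1)`, pivot `M 0 0 ≠ 0`. -/
theorem schur_identity (k : ℕ) (M : ℕ → ℕ → ℝ) (hM : ∀ i j, M i j = M j i) (hd : M 0 0 ≠ 0) (v : ℕ → ℝ) :
    ∑ i ∈ range (k + 1), ∑ j ∈ range (k + 1), v i * M i j * v j =
      M 0 0 * (v 0 + (∑ i ∈ range k, M 0 (i + 1) * v (i + 1)) / M 0 0) ^ 2 +
      ∑ i ∈ range k, ∑ j ∈ range k,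
        v (i + 1) * (M (i + 1) (j + 1) - M (i + 1) 0 * M 0 (j + 1) / M 0 0) * v (j + 1) := by
  have h0 : ∀ i, M (i + 1) 0 = M 0 (i + 1) := fun i => hM _ _
  simp only [sum_range_succ', h0]
  set s := ∑ i ∈ range k, M 0 (i + 1) * v (i + 1) with hs
  have e1 : ∑ i ∈ range k, v (i + 1) * M 0 (i + 1) * v 0 = v 0 * s := by
    rw [hs, mul_sum]; exact sum_congr rfl fun i _ => by ring
  have e2 : ∑ j ∈ range k, v 0 * M 0 (j + 1) * v (j + 1) = v 0 * s := by
    rw [hs, mul_sum]; exact sum_congr rfl fun i _ => by ring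
  have e3 : ∑ i ∈ range k, ∑ j ∈ range k,
      v (i + 1) * (M (i + 1) (j + 1) - M 0 (i + 1) * M 0 (j + 1) / M 0 0) * v (j + 1) =
      ∑ i ∈ range k, ∑ j ∈ range k, v (i + 1) * M (i + 1) (j + 1) * v (j + 1) - s * s / M 0 0 := by
    rw [hs, sum_mul_sum, sum_div, ← sum_sub_distrib]
    refine sum_congr rfl fun i _ => ?_
    rw [sum_div, ← sum_sub_distrib]
    refine sum_congr rfl fun j _ => ?_
    ring
  rw [sum_add_distrib, e1, e2, e3]
  field_simp
  ring

/-- Soundness of the `LDLᵀ` test: all pivots positive ⇒ the real quadratic form is nonnegative. -/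
theorem ldlPos_sound : ∀ (k : ℕ) (M : ℕ → ℕ → ℚ), (∀ i j, M i j = M j i) → ldlPos k M = true →
    ∀ v : ℕ → ℝ, 0 ≤ ∑ i ∈ range k, ∑ j ∈ range k, v i * (M i j : ℝ) * v j
  | 0, _, _, _, _ => by simp
  | k + 1, M, hM, h, v => by
    simp only [ldlPos, Bool.and_eq_true, decide_eq_true_eq] at h
    obtain ⟨hd, h⟩ := h
    have hM' : ∀ i j, M (i + 1) (j + 1) - M (i + 1) 0 * M 0 (j + 1) / M 0 0 =
        M (j + 1) (i + 1) - M (j + 1) 0 * M 0 (i + 1) / M 0 0 := by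
      intro i j; rw [hM (j + 1) (i + 1), hM (j + 1) 0, hM 0 (i + 1)]; ring
    have ih := ldlPos_sound k _ hM' h (fun i => v (i + 1))
    push_cast at ih
    have hMr : ∀ i j, (M i j : ℝ) = (M j i : ℝ) := fun i j => by rw [hM i j]
    have hd' : (0 : ℝ) < (M 0 0 : ℝ) := by exact_mod_cast hd
    have key := schur_identity k (fun i j => (M i j : ℝ)) hMr hd'.ne' v
    rw [key]
    exact add_nonneg (mul_nonneg hd'.le (sq_nonneg _)) ih

/-- Abel summation with vanishing total sum. -/
theorem abel0 (n : ℕ) (f y : ℕ → ℝ) (hy : ∑ i ∈ range n, y i = 0) :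
    ∑ i ∈ range n, f i * y i =
      ∑ i ∈ range (n - 1), (f i - f (i + 1)) * ∑ t ∈ range (i + 1), y t := by
  have h := sum_range_by_parts f y n
  simp only [smul_eq_mul] at h
  rw [h, hy, mul_zero, zero_sub, ← sum_neg_distrib]
  exact sum_congr rfl fun i _ => by ring

/-- `yᵀ X y = zᵀ (Pᵀ X P) z` for `Σ y = 0`, `z` the partial sums of `y`. -/
theorem pxp_identity (n : ℕ) (X : ℕ → ℕ → ℝ) (y : ℕ → ℝ) (hy : ∑ i ∈ range n, y i = 0) :
    ∑ i ∈ range n, ∑ j ∈ range n, y i * X i j * y j =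
      ∑ i ∈ range (n - 1), ∑ j ∈ range (n - 1),
        (∑ t ∈ range (i + 1), y t) * (X i j - X i (j + 1) - X (i + 1) j + X (i + 1) (j + 1)) *
          (∑ t ∈ range (j + 1), y t) := by
  have step1 : ∑ i ∈ range n, ∑ j ∈ range n, y i * X i j * y j =
      ∑ i ∈ range n, (∑ j ∈ range n, X i j * y j) * y i := by
    refine sum_congr rfl fun i _ => ?_
    rw [sum_mul]; exact sum_congr rfl fun j _ => by ring
  rw [step1, abel0 n _ y hy]
  refine sum_congr rfl fun i _ => ?_
  rw [← sum_sub_distrib]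
  have step2 : ∑ j ∈ range n, (X i j * y j - X (i + 1) j * y j) =
      ∑ j ∈ range n, (X i j - X (i + 1) j) * y j :=
    sum_congr rfl fun j _ => by ring
  rw [step2, abel0 n _ y hy, sum_mul]
  exact sum_congr rfl fun j _ => by ring

/-- Weighted AM–GM term bound: `|e| ≤ r ⇒ a e b ≥ −r (a² + b²)/2`. -/
theorem term_bound (a b e r : ℝ) (he : |e| ≤ r) : -(r * (a ^ 2 + b ^ 2) / 2) ≤ a * e * b := by
  have h2 : 2 * (|a| * |b|) ≤ a ^ 2 + b ^ 2 := by
    have := two_mul_le_add_sq |a| |b|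
    simp only [sq_abs] at this; linarith
  have h1 : |a * e * b| ≤ r * (a ^ 2 + b ^ 2) / 2 := by
    rw [abs_mul, abs_mul]
    calc |a| * |e| * |b| = |e| * (|a| * |b|) := by ring
      _ ≤ r * (|a| * |b|) := by gcongr
      _ ≤ r * ((a ^ 2 + b ^ 2) / 2) :=
          mul_le_mul_of_nonneg_left (by linarith) ((abs_nonneg e).trans he)
      _ = r * (a ^ 2 + b ^ 2) / 2 := by ring
  have := neg_abs_le (a * e * b)
  linarith

/-- Perturbation bound: `|E_ij| ≤ rad_ij` (symmetric `rad`) ⇒ `yᵀ E y ≥ −Σ_i (Σ_j rad_ij) y_i²`. -/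
theorem pert_bound (N : Finset ℕ) (E rad : ℕ → ℕ → ℝ) (y : ℕ → ℝ)
    (hE : ∀ i ∈ N, ∀ j ∈ N, |E i j| ≤ rad i j) (hrad : ∀ i j, rad i j = rad j i) :
    -(∑ i ∈ N, (∑ j ∈ N, rad i j) * y i ^ 2) ≤ ∑ i ∈ N, ∑ j ∈ N, y i * E i j * y j := by
  have h1 : ∑ i ∈ N, ∑ j ∈ N, -(rad i j * (y i ^ 2 + y j ^ 2) / 2) ≤ ∑ i ∈ N, ∑ j ∈ N, y i * E i j * y j :=
    sum_le_sum fun i hi => sum_le_sum fun j hj => term_bound _ _ _ _ (hE i hi j hj)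
  have h2 : ∑ i ∈ N, ∑ j ∈ N, -(rad i j * (y i ^ 2 + y j ^ 2) / 2) = -(∑ i ∈ N, (∑ j ∈ N, rad i j) * y i ^ 2) := by
    have e : ∀ i j, -(rad i j * (y i ^ 2 + y j ^ 2) / 2) = -(rad i j * y i ^ 2 / 2) + -(rad i j * y j ^ 2 / 2) := by
      intros; ring
    simp_rw [e, sum_add_distrib]
    have hc : ∑ i ∈ N, ∑ j ∈ N, -(rad i j * y j ^ 2 / 2) = ∑ j ∈ N, ∑ i ∈ N, -(rad i j * y j ^ 2 / 2) := sum_comm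
    rw [hc, ← sum_add_distrib, ← sum_neg_distrib]
    refine sum_congr rfl fun i _ => ?_
    rw [← sum_add_distrib, sum_mul, ← sum_neg_distrib]
    refine sum_congr rfl fun j _ => ?_
    rw [hrad j i]; ring
  linarith

/-- Diagonal kernels: `Σ_ij y_i [i=j] c_i y_j = Σ_i c_i y_i²`. -/
theorem qf_diag (N : Finset ℕ) (c y : ℕ → ℝ) :
    ∑ i ∈ N, ∑ j ∈ N, y i * (if i = j then c i else 0) * y j = ∑ i ∈ N, c i * y i ^ 2 := by
  refine sum_congr rfl fun i hi => ?_
  simp only [mul_ite, mul_zero, ite_mul, zero_mul, sum_ite_eq, hi, if_true]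
  ring

/-- `midM` is symmetric. -/
theorem midM_symm (lo hi : ℕ → ℕ → ℚ) (i j : ℕ) : midM lo hi i j = midM lo hi j i := by
  unfold midM; ring

/-- `radM` is symmetric. -/
theorem radM_symm (lo hi : ℕ → ℕ → ℚ) (i j : ℕ) : radM lo hi i j = radM lo hi j i := by
  unfold radM; ring

/-- `rowR` is the row sum of `radM`. -/
theorem rowR_eq (n : ℕ) (lo hi : ℕ → ℕ → ℚ) (i : ℕ) : rowR n lo hi i = ∑ j ∈ range n, radM lo hi i j := by
  unfold rowR
  induction n with
  | zero => simp
  | succ n ih => rw [List.range_succ, List.foldr_append, Finset.sum_range_succ]; simp only [List.foldr_cons,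
      List.foldr_nil, add_zero]; rw [← ih]; clear ih; induction (List.range n) with
      | nil => simp
      | cons a l ihl => simp only [List.foldr_cons, ihl]; ring

/-- `XM` is symmetric. -/
theorem XM_symm (γ : ℚ) (n : ℕ) (lo hi : ℕ → ℕ → ℚ) : ∀ i j, XM γ n lo hi i j = XM γ n lo hi j i := by
  intro i j
  unfold XM
  by_cases h : i = j
  · subst h; rfl
  · rw [if_neg h, if_neg (Ne.symm h), midM_symm]

/-- `GM` preserves symmetry. -/
theorem GM_symm (X : ℕ → ℕ → ℚ) (hX : ∀ i j, X i j = X j i) : ∀ i j, GM X i j = GM X j i := by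
  intro i j
  simp only [GM]
  rw [hX j i, hX j (i + 1), hX (j + 1) i, hX (j + 1) (i + 1)]
  ring

/-- **Soundness of the per-block test**: entrywise enclosures of a symmetric real kernel `Hm` on `range n`
plus `blockOK` give `64 n γ Σ y_i² ≤ Σ_ij y_i Hm_ij y_j` for every real `y` with `Σ_{i<n} y_i = 0`. -/
theorem blockOK_sound (n : ℕ) (γ : ℚ) (lo hi : ℕ → ℕ → ℚ) (Hm : ℕ → ℕ → ℝ)
    (hsym : ∀ i j, Hm i j = Hm j i)
    (henc : ∀ i j, i < n → j < n → ((lo i j : ℚ) : ℝ) ≤ Hm i j ∧ Hm i j ≤ ((hi i j : ℚ) : ℝ))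
    (hok : blockOK γ n lo hi = true)
    (y : ℕ → ℝ) (hy : ∑ i ∈ range n, y i = 0) :
    (64 * n * (γ : ℝ)) * ∑ i ∈ range n, y i ^ 2 ≤ ∑ i ∈ range n, ∑ j ∈ range n, y i * Hm i j * y j := by
  have hb : ∀ i ∈ range n, ∀ j ∈ range n,
      |Hm i j - (midM lo hi i j : ℝ)| ≤ (radM lo hi i j : ℝ) := by
    intro i hi' j hj'
    rw [mem_range] at hi' hj'
    obtain ⟨h1, h2⟩ := henc i j hi' hj'
    obtain ⟨h3, h4⟩ := henc j i hj' hi'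
    rw [hsym j i] at h3 h4
    simp only [midM, radM, abs_le]
    push_cast
    constructor <;> linarith
  have hE := pert_bound (range n) (fun i j => Hm i j - (midM lo hi i j : ℝ)) (fun i j => (radM lo hi i j : ℝ)) y hb
    (fun i j => by simp only [radM_symm lo hi i j])
  have hX : 0 ≤ ∑ i ∈ range n, ∑ j ∈ range n, y i * (XM γ n lo hi i j : ℝ) * y j := by
    have h1 := pxp_identity n (fun i j => (XM γ n lo hi i j : ℝ)) y hy
    have h2 := ldlPos_sound (n - 1) (GM (XM γ n lo hi)) (GM_symm _ (XM_symm γ n lo hi)) hok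
      (fun i => ∑ t ∈ range (i + 1), y t)
    simp only [GM] at h2
    push_cast at h2
    rw [h1]; exact h2
  have hXc : ∀ i j, (XM γ n lo hi i j : ℝ) =
      (midM lo hi i j : ℝ) - if i = j then (64 * n * (γ : ℝ) + ∑ j' ∈ range n, (radM lo hi i j' : ℝ)) else 0 := by
    intro i j
    unfold XM
    rw [rowR_eq]
    split_ifs <;> push_cast <;> ring
  have hXq : ∑ i ∈ range n, ∑ j ∈ range n, y i * (XM γ n lo hi i j : ℝ) * y j =
      ∑ i ∈ range n, ∑ j ∈ range n, y i * (midM lo hi i j : ℝ) * y j -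
      ∑ i ∈ range n, (64 * n * (γ : ℝ) + ∑ j' ∈ range n, (radM lo hi i j' : ℝ)) * y i ^ 2 := by
    rw [← qf_diag (range n) _ y, ← sum_sub_distrib]
    refine sum_congr rfl fun i _ => ?_
    rw [← sum_sub_distrib]
    refine sum_congr rfl fun j _ => ?_
    rw [hXc]; ring
  have hEq : ∑ i ∈ range n, ∑ j ∈ range n, y i * (Hm i j - (midM lo hi i j : ℝ)) * y j =
      ∑ i ∈ range n, ∑ j ∈ range n, y i * Hm i j * y j -
      ∑ i ∈ range n, ∑ j ∈ range n, y i * (midM lo hi i j : ℝ) * y j := by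
    rw [← sum_sub_distrib]
    refine sum_congr rfl fun i _ => ?_
    rw [← sum_sub_distrib]
    refine sum_congr rfl fun j _ => ?_
    ring
  have hsplit : ∑ i ∈ range n, (64 * n * (γ : ℝ) + ∑ j' ∈ range n, (radM lo hi i j' : ℝ)) * y i ^ 2 =
      (64 * n * (γ : ℝ)) * ∑ i ∈ range n, y i ^ 2 +
      ∑ i ∈ range n, (∑ j' ∈ range n, (radM lo hi i j' : ℝ)) * y i ^ 2 := by
    rw [mul_sum, ← sum_add_distrib]
    exact sum_congr rfl fun i _ => by ring
  linarith

/-! ### The bisection driver -/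

namespace IBox

/-- No sorted point lies in a box that misses the chamber. -/
theorem not_mem_of_outsideSorted {S : ℕ} {B : IBox} (h : B.outsideSorted = true) {C : Fin 4 → ℝ}
    (hC : B.mem S C) (h01 : C 0 ≤ C 1) (h12 : C 1 ≤ C 2) (h23 : C 2 ≤ C 3) : False := by
  simp only [outsideSorted, Bool.or_eq_true, decide_eq_true_eq] at h
  have m0 := hC.out 0; have m1 := hC.out 1; have m2 := hC.out 2; have m3 := hC.out 3
  simp only [Fin.val_zero, Fin.val_one, show ((2 : Fin 4) : ℕ) = 2 from rfl,
    show ((3 : Fin 4) : ℕ) = 3 from rfl] at m0 m1 m2 m3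
  have hS : (0 : ℝ) ≤ S := Nat.cast_nonneg _
  rcases h with (h | h) | h
  · have : ((B.ivl 1).2 : ℝ) < (B.ivl 0).1 := by exact_mod_cast h
    nlinarith [m0.1, m1.2, mul_le_mul_of_nonneg_right h01 hS]
  · have : ((B.ivl 2).2 : ℝ) < (B.ivl 1).1 := by exact_mod_cast h
    nlinarith [m1.1, m2.2, mul_le_mul_of_nonneg_right h12 hS]
  · have : ((B.ivl 3).2 : ℝ) < (B.ivl 2).1 := by exact_mod_cast h
    nlinarith [m2.1, m3.2, mul_le_mul_of_nonneg_right h23 hS]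

/-- `ivl` of a modified box. -/
theorem ivl_set (B : IBox) (k j : ℕ) (v : ℤ × ℤ) :
    IBox.ivl (B.set k v) j = if k = j ∧ k < B.length then v else B.ivl j := by
  unfold ivl
  rw [List.getD_eq_getElem?_getD, List.getElem?_set, List.getD_eq_getElem?_getD]
  by_cases hkj : k = j
  · subst hkj
    by_cases hk : k < B.length
    · simp [hk]
    · simp [hk]
  · simp [hkj]

/-- The two halves of a bisection cover the box. -/
theorem mem_split {S : ℕ} {B : IBox} {C : Fin 4 → ℝ} (hC : B.mem S C) (k : ℕ) :
    (B.split k).1.mem S C ∨ (B.split k).2.mem S C := by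
  by_cases hk : k < B.length
  · have key : ∀ j : Fin 4, (j : ℕ) ≠ k →
        IBox.ivl (B.split k).1 j = B.ivl j ∧ IBox.ivl (B.split k).2 j = B.ivl j := by
      intro j hj
      have h' : ¬(k = (j : ℕ) ∧ k < B.length) := fun h => hj h.1.symm
      simp only [split, ivl_set, h', if_false, and_self]
    have self1 : IBox.ivl (B.split k).1 k = ((B.ivl k).1, ((B.ivl k).1 + (B.ivl k).2) / 2) := by
      simp only [split, ivl_set, hk, and_self, if_true]
    have self2 : IBox.ivl (B.split k).2 k = (((B.ivl k).1 + (B.ivl k).2) / 2, (B.ivl k).2) := by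
      simp only [split, ivl_set, hk, and_self, if_true]
    by_cases hex : ∃ j : Fin 4, (j : ℕ) = k ∧ ((((B.ivl k).1 + (B.ivl k).2) / 2 : ℤ) : ℝ) < C j * S
    · obtain ⟨j₀, hj₀, hlt⟩ := hex
      right
      refine ⟨fun j => ?_⟩
      by_cases hj : (j : ℕ) = k
      · have e : j = j₀ := Fin.ext (by rw [hj, hj₀])
        subst e
        rw [hj, self2]
        exact ⟨le_of_lt hlt, (by have := (hC.out j).2; rwa [hj] at this)⟩
      · rw [(key j hj).2]; exact hC.out j
    · push Not at hex
      left
      refine ⟨fun j => ?_⟩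
      by_cases hj : (j : ℕ) = k
      · rw [hj, self1]
        exact ⟨(by have := (hC.out j).1; rwa [hj] at this), hex j hj⟩
      · rw [(key j hj).1]; exact hC.out j
  · have e1 : (B.split k).1 = B := by
      simp only [split]; exact List.set_eq_of_length_le (not_lt.1 hk)
    left; rw [e1]; exact hC

end IBox

/-- **Soundness of the bisection driver** (generic in the leaf test): if accepted leaves prove `P` on their box,
an accepted box proves `P` at every SORTED point of the box. -/
theorem certify_sound (S : ℕ) (P : (Fin 4 → ℝ) → Prop) (leafOK : IBox → Bool)
    (hleaf : ∀ B, leafOK B = true → ∀ C, IBox.mem S B C → P C) :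
    ∀ (f : ℕ) (B : IBox), certify leafOK f B = true → ∀ C, IBox.mem S B C →
      C 0 ≤ C 1 → C 1 ≤ C 2 → C 2 ≤ C 3 → P C := by
  intro f
  induction f with
  | zero =>
    intro B h C hC h01 h12 h23
    simp only [certify, Bool.or_eq_true] at h
    rcases h with h | h
    · exact (IBox.not_mem_of_outsideSorted h hC h01 h12 h23).elim
    · exact hleaf B h C hC
  | succ f ih =>
    intro B h C hC h01 h12 h23
    simp only [certify, Bool.or_eq_true, Bool.and_eq_true] at h
    rcases h with (h | h) | ⟨h1, h2⟩
    · exact (IBox.not_mem_of_outsideSorted h hC h01 h12 h23).elim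
    · exact hleaf B h C hC
    · rcases IBox.mem_split hC B.widest with hm | hm
      · exact ih _ h1 C hm h01 h12 h23
      · exact ih _ h2 C hm h01 h12 h23

/-! ### Bit masks -/

/-- The sixteen bit masks enumerate the Walsh classes. -/
theorem bitsFun_bijective : Function.Bijective (fun b : Fin 16 => bitsFun b.val) := by decide

/-- `xor` of masks is addition of classes. -/
theorem bitsFun_xor : ∀ b₁ b₂ : Fin 16, bitsFun (b₁.val ^^^ b₂.val) = bitsFun b₁.val + bitsFun b₂.val := by decide

/-- Sums over classes as sums over the sixteen masks. -/
theorem sum_class_eq_sum_range {M : Type*} [AddCommMonoid M] (f : (Fin 4 → ZMod 2) → M) :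
    ∑ σ, f σ = ∑ b ∈ range 16, f (bitsFun b) := by
  rw [← Fin.sum_univ_eq_sum_range (fun b => f (bitsFun b)) 16]
  exact (Fintype.sum_bijective _ bitsFun_bijective (fun b => f (bitsFun b.val)) f fun _ => rfl).symm


/-- **Registered helper `stub_checkerCertifySound`** (= `certify_sound`). -/
theorem stub_checkerCertifySound : ∀ (S : ℕ) (P : (Fin 4 → ℝ) → Prop) (leafOK : IBox → Bool), (∀ B, leafOK B = true → ∀ C, IBox.mem S B C → P C) → ∀ (f : ℕ) (B : IBox), certify leafOK f B = true → ∀ C, IBox.mem S B C → C 0 ≤ C 1 → C 1 ≤ C 2 → C 2 ≤ C 3 → P C :=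
  certify_sound

end Summit.QuantumFields.QCD.Cruxes.CriticalLineDiamagnetism.ChessboardCellGain.Checker
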